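import Summits.QuantumFields.YangMills.Theorems.FluctuationComparisonRegPrIntLS2BetaWhitneyHatLift
import Summits.QuantumFields.YangMills.Theorems.FluctuationComparisonRegPrIntLS2BetaCentralLineTreeComb
import Summits.QuantumFields.YangMills.Theorems.FluctuationComparisonRegPrIntLS2BetaSmallBondGaugeToronObstruction
import HarnessLib

/-!
# S2β · c₃ — THE CENTRAL FACE BOND's DISCREPANCY IS THE RELATIVE (0.4) CORRECTION FACTOR UP TO ONE COMMUTATOR:
# `dist1 ε(b₀(c)) ≤ dist1 (κ_W·κ_{W₁}⁻¹) + 2·dist1 κ_{W₁}·(((L+1)∕2)·dist1 R(b₀(c)))` for the two `AxStage` stage towers (group algebra + the lattice instantiation)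

Cell `ym3-torus` (YM ladder rung R3 = continuum `SU(2)` Yang–Mills on the three-torus at fixed lattice data — a RUNG: NOT d = 4, NOT infinite volume,
NOT a mass gap, NOT Clay).  Width seat «width 20» `ym3-torus-px20` (gen 24), FREE px helper on crux `stmt-QuantumFields-20520`
(`…Theses.UnitScaleTilt.FluctuationComparisonRegPrIntL`), LINE g18-1 S2β, the (ST) sup chain; c₃ ASSEMBLER per ARCHITECT RULINGS px17 g22 19:24:49Z (i)
«`c₃(t+1) := (1+κ⁻¹)·Σ_B max_{face-crossing ℓ′ ∈ READ′_{t+1}(B)} |log ε(ℓ′)|²`, `ε := R⁻¹η`; inputs (O3-LOC)+(O3b) ✓p831296∕✓p831574 for `ε(b₀(c))` (first order = `Idx`-mean of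
covariant CLOSED-loop sums ⇒ c₁'s curl currency; remainder ⇒ FEEDBACK), Q11 ladders off-centre» and 19:37:59Z (1) (one-profile).  After ✓p832421 (the row engine) and
✓p832977 (the tower row with the letter-free discrepancy energy `D′`), THIS FILE discharges the CENTRAL-bond part of the face discrepancy BY NAME: at `b₀(c)` the
discrepancy `ε` of the two stage towers is the RELATIVE (0.4) CORRECTION FACTOR `κ_W·κ_{W₁}⁻¹` (lit `BlockAveraging.corr`) up to ONE COMMUTATOR price
`2·dist1 κ_{W₁}·((k+1)·dist1 R)` (absolute correction factor × relative lift — feedback currency).  Mechanism ([Balaban1987RG1] (0.4): `Ū(c) = κ·U([emb c₋, emb c₊])`):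
under `AxStage` (T4) the comb bonds of the central line carry the hat lift, which is the `L`-th geodesic root `a = expPoint(L⁻¹·logVec X(c))` on the WHOLE line
(px12 g26's ✓`lift_line`, weight `1` on `c`), and (T5) says the average of the stage field IS the next stage field; so `X(c) = κ·(a^k·u·a^k)` with `u` the face chord and
`X(c) = a^{2k+1}` (`k = (L−1)∕2`) — solved: `u = (a^k)⁻¹κ⁻¹a^{k+1}`, hence `R⁻¹η = a₁·(Ad_{a^{−(k+1)}}κ⁻¹·Ad_{a₁^{−(k+1)}}κ₁)·a₁⁻¹` for the pair.
`--kind proof --supports stmt-QuantumFields-20520 --as helper`, count-neutral, DEFINITION-FREE (0 `def`, 0 `instance`, 0 `notation`, 0 `sorry`, default heartbeats); §1–§2 ANY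
`GaugeGroup` (+ the commutator letter `hcomm : dist1 [g,h] ≤ 2·dist1 g·dist1 h`, inhabited on `SU(2)` by the tree's `dist1_comm_le`-type facts, as in px21's ✓p831943 ∕ px12's (d));
§3 `SU(2)`, generic `P : Params`, levels `j`∕`j+1`, standing range, ANY `LoopAverage ℰ` (the tower's averaging = `blockAvg ℰ`).

WHAT IS PROVED (sorry-free).
* §1 `dist1_pow_mul_inv_pow_le : dist1 (aⁿ·(a₁ⁿ)⁻¹) ≤ n·dist1 (a·a₁⁻¹)`.
* §2 `faceChord_eq_of_avg : κ·(a^k·u·a^k) = a^{k+(k+1)} → u = (a^k)⁻¹·κ⁻¹·a^{k+1}`; ★★`centralDisc_eq_conj` (the exact conjugate form of `(a·a₁⁻¹)⁻¹·(u·u₁⁻¹)`);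
  ★★★`dist1_centralDisc_le (hcomm) : dist1 ((a·a₁⁻¹)⁻¹·(u·u₁⁻¹)) ≤ dist1 (κ·κ₁⁻¹) + 2·dist1 κ₁·((k+1)·dist1 (a·a₁⁻¹))`.
* §3 `rowProd_eq_pow_of_eq`, `centralLine_treeComb` (the central-line bonds `t ≠ k` are tree-comb: ✓p831574 `blockOf_shiftN_emb_of_le∕_of_ge`, `rel_emb_…`),
  ★★`avg_identity_central` (ONE tower: `hwt`, `hlift`, (T4) `hT4`, (T5) `hT5 : (blockAvg ℰ).avg (g_j • Ū^jU) = g_{j+1} • Ū^{j+1}U` ⟹ `corr ℰ W c·(a^k·W (b₀ c)·a^k) = a^{k+(k+1)}`,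
  via ✓`stageField_treeComb_eq_lift`, ✓`lift_line`, lit ✓`axialAvg_eq_rowProd` ∕ ✓`rowProd_eq_split` ∕ ✓`b0_eq_shiftN_emb`, ✓`expPoint_smul_pow` + lit ✓`expPoint_logVec`),
  ★★★`dist1_centralDisc_le_stage` — BOTH towers + `hcomm`:
  `dist1 ((lift_j X (b₀ c)·(lift_j X₁ (b₀ c))⁻¹)⁻¹·(W (b₀ c)·(W₁ (b₀ c))⁻¹)) ≤ dist1 (corr ℰ W c·(corr ℰ W₁ c)⁻¹) + 2·dist1 (corr ℰ W₁ c)·(((L−1)∕2 + 1)·dist1 (lift_j X (b₀ c)·(lift_j X₁ (b₀ c))⁻¹))`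
  (`W = g_j • Ū^jU`, `X = g_{j+1} • Ū^{j+1}U`, `W₁, X₁` for `(g₀, U₁)`, all spelled out; the `AxStage` clause texts `hwt`∕`hlift`∕`hT4`∕`hT5` as in ✓`axStage_exists`).

CONSUMERS.  px5 g23 ⧗Q11g `…LiftLadderPerBlockRow`'s `hface` at the CENTRAL bond: arc edition via lit-side ✓`norm_logVec_le_pi_div_two_mul_dist1` (`‖logVec (su2Quat ε)‖ ≤ (π∕2)·dist1 ε`);
off-centre face bonds = central + px5's transverse ladders (Q11 lineage); the relative correction factor `κ_W·κ_{W₁}⁻¹` is (O3-LOC)'s object — ✓p831296 §3 linearises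
`Ū·Ū₀* − 1` into the `Idx`-mean `covLinAvgR0` of covariant sums over CLOSED loop words (px13∕px16's curl currency; px20's ✓`sum_idx_run_face` re-indexes the face part).

INHABITATION (★★OWNER RULING №100): LAW-FREE — group algebra over the `AxStage` witness clauses ((T4), (T5) are conjuncts of ✓`axStage_exists`); `hcomm` is the standard `SU(2)` letter.

HONEST SCOPE.  Group algebra and lattice bookkeeping over landed letters by name; nothing of Bałaban's renormalisation-group analysis is asserted or proved ([Balaban1987RG1] (0.4)
p.253 — the averaging with its correction factor; [Balaban1985Averaging] (19)–(20) p.21, (9) p.19; [Balaban1985RegularSpaces] (1.19) p.79, (1.29) p.81); the bound on the relative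
correction factor itself, the arc profile, (TOP-LAD′), the budgets (SCT′), (ST″)∕(ST′)∕(ST), LOC″∕LOC are HYPOTHESES ∕ other files; GAP♯∘ (`stub_uniformFibreGapOrbit`, registry
3732b7df UNTOUCHED), the five registered stubs (0∕5), S2β, 20520, 19936, 19200, `YM3TorusSU2` are NOT proved; no registered stub is closed; rung R3 — NOT d = 4, NOT infinite
volume, NOT a mass gap, NOT Clay; the Yang–Mills mass gap is NOT proved.
-/

set_option autoImplicit false

namespace Summit.QuantumFields.YangMills.Theorems.FluctuationComparisonRegPrIntLS2BetaCentralFaceDiscrepancy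

open Literature.MathematicalPhysics.QuantumFieldTheory.Balaban1983to89

variable {G : Type*} [GaugeGroup G]

/-! ## §1 Powers: `dist1 (aⁿ·(a₁ⁿ)⁻¹) ≤ n·dist1 (a·a₁⁻¹)` -/

/-- **RELATIVE POWERS**: `dist1 (a^n·(a₁^n)⁻¹) ≤ n·dist1 (a·a₁⁻¹)` (telescoping `a^{n+1}(a₁^{n+1})⁻¹ = (a^n (a a₁⁻¹) a^{-n})·(a^n (a₁^n)⁻¹)`, conjugation
invariance and subadditivity of `dist1`). [cite: Balaban1985Averaging, (19)-(20) p.21] -/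
theorem dist1_pow_mul_inv_pow_le (a a₁ : G) : ∀ n : ℕ, dist1 (a ^ n * (a₁ ^ n)⁻¹) ≤ (n : ℝ) * dist1 (a * a₁⁻¹)
  | 0 => by simp [GaugeGroup.dist1_one]
  | n + 1 => by
    have key : a ^ (n + 1) * (a₁ ^ (n + 1))⁻¹ = (a ^ n * (a * a₁⁻¹) * (a ^ n)⁻¹) * (a ^ n * (a₁ ^ n)⁻¹) := by
      rw [pow_succ, pow_succ]; group
    rw [key]
    have h1 := GaugeGroup.dist1_mul_le (a ^ n * (a * a₁⁻¹) * (a ^ n)⁻¹) (a ^ n * (a₁ ^ n)⁻¹)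
    rw [GaugeGroup.dist1_conj] at h1
    have h2 := dist1_pow_mul_inv_pow_le a a₁ n
    push_cast
    linarith

/-! ## §2 The central bond: solving the averaging identity for the face chord, and the discrepancy -/

/-- **THE FACE CHORD SOLVED FROM THE AVERAGING IDENTITY**: if the coarse chord `a^{2k+1}` (`a` the lift's `L`-th root, `L = 2k+1`) equals the correction factor `κ` times the
central-line product `a^k·u·a^k` (comb bonds carry the lift `a`, the face bond carries `u`), then `u = (a^k)⁻¹·κ⁻¹·a^{k+1}`.
[cite: Balaban1987RG1, (0.4) p.253; Balaban1985RegularSpaces, (1.19) p.79] -/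
theorem faceChord_eq_of_avg (a κ u : G) (k : ℕ) (hu : κ * (a ^ k * u * a ^ k) = a ^ (k + (k + 1))) :
    u = (a ^ k)⁻¹ * κ⁻¹ * a ^ (k + 1) := by
  have h1 : u = (a ^ k)⁻¹ * (κ⁻¹ * (κ * (a ^ k * u * a ^ k))) * (a ^ k)⁻¹ := by group
  rw [hu, pow_add] at h1
  rw [h1]
  group

/-- ★★ **THE CENTRAL DISCREPANCY AS A CONJUGATE OF TWO TWISTED CORRECTION FACTORS**: with `u, u₁` the two towers' face chords solved as above,
`(a·a₁⁻¹)⁻¹·(u·u₁⁻¹) = a₁·((a^{k+1})⁻¹κ⁻¹a^{k+1}·((a₁^{k+1})⁻¹κ₁a₁^{k+1}))·a₁⁻¹`. [cite: Balaban1987RG1, (0.4) p.253] -/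
theorem centralDisc_eq_conj (a a₁ κ κ₁ u u₁ : G) (k : ℕ)
    (hu : κ * (a ^ k * u * a ^ k) = a ^ (k + (k + 1))) (hu₁ : κ₁ * (a₁ ^ k * u₁ * a₁ ^ k) = a₁ ^ (k + (k + 1))) :
    (a * a₁⁻¹)⁻¹ * (u * u₁⁻¹) =
      a₁ * (((a ^ (k + 1))⁻¹ * κ⁻¹ * a ^ (k + 1)) * ((a₁ ^ (k + 1))⁻¹ * κ₁ * a₁ ^ (k + 1))) * a₁⁻¹ := by
  rw [faceChord_eq_of_avg a κ u k hu, faceChord_eq_of_avg a₁ κ₁ u₁ k hu₁]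
  group

/-- ★★★ **THE CENTRAL FACE BOND's DISCREPANCY IS THE RELATIVE CORRECTION FACTOR UP TO ONE COMMUTATOR.**  In any gauge group with the commutator letter
`dist1 [g, h] ≤ 2·dist1 g·dist1 h` (`SU(N)`): if the two towers' coarse chords at `c` satisfy the (0.4) identities `κ·(a^k·u·a^k) = a^{2k+1}`, `κ₁·(a₁^k·u₁·a₁^k) = a₁^{2k+1}`
(`a, a₁` the two lifts' values on the central line, `u, u₁` the two face chords at `b₀(c)`, `κ, κ₁` the two correction factors), then the discrepancy `ε := R⁻¹·η` at the central
face bond (`R = a·a₁⁻¹`, `η = u·u₁⁻¹`) obeys `dist1 ε ≤ dist1 (κ·κ₁⁻¹) + 2·dist1 κ₁·((k+1)·dist1 (a·a₁⁻¹))` — the RELATIVE correction factor plus an (absolute × relative) commutator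
price (FEEDBACK currency: `dist1 κ₁` is small, `(k+1)·dist1 (a·a₁⁻¹) ≤ ½·`parent relative chord). [cite: Balaban1987RG1, (0.4) p.253; Balaban1985Averaging, (19)-(20) p.21] -/
theorem dist1_centralDisc_le (hcomm : ∀ g h : G, dist1 (g * h * g⁻¹ * h⁻¹) ≤ 2 * dist1 g * dist1 h) (a a₁ κ κ₁ u u₁ : G) (k : ℕ)
    (hu : κ * (a ^ k * u * a ^ k) = a ^ (k + (k + 1))) (hu₁ : κ₁ * (a₁ ^ k * u₁ * a₁ ^ k) = a₁ ^ (k + (k + 1))) :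
    dist1 ((a * a₁⁻¹)⁻¹ * (u * u₁⁻¹)) ≤ dist1 (κ * κ₁⁻¹) + 2 * dist1 κ₁ * (((k + 1 : ℕ) : ℝ) * dist1 (a * a₁⁻¹)) := by
  rw [centralDisc_eq_conj a a₁ κ κ₁ u u₁ k hu hu₁, GaugeGroup.dist1_conj]
  -- conjugate by `A := a^{k+1}`: the product becomes `κ⁻¹·(g κ₁ g⁻¹)` with `g := A·B⁻¹`
  set A : G := a ^ (k + 1) with hA
  set B : G := a₁ ^ (k + 1) with hB
  have key : A⁻¹ * κ⁻¹ * A * (B⁻¹ * κ₁ * B) = A⁻¹ * ((κ⁻¹ * κ₁) * (κ₁⁻¹ * (A * B⁻¹) * κ₁⁻¹⁻¹ * (A * B⁻¹)⁻¹)) * A⁻¹⁻¹ := by group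
  rw [key, GaugeGroup.dist1_conj]
  have h1 := GaugeGroup.dist1_mul_le (κ⁻¹ * κ₁) (κ₁⁻¹ * (A * B⁻¹) * κ₁⁻¹⁻¹ * (A * B⁻¹)⁻¹)
  have h2 := hcomm κ₁⁻¹ (A * B⁻¹)
  rw [GaugeGroup.dist1_inv] at h2
  -- `dist1 (κ⁻¹κ₁) = dist1 (κκ₁⁻¹)`
  have h3 : dist1 (κ⁻¹ * κ₁) = dist1 (κ * κ₁⁻¹) := by
    have e : κ⁻¹ * κ₁ = κ⁻¹ * (κ * κ₁⁻¹)⁻¹ * κ⁻¹⁻¹ := by group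
    rw [e, GaugeGroup.dist1_conj, GaugeGroup.dist1_inv]
  -- `dist1 (A B⁻¹) ≤ (k+1)·dist1 (a a₁⁻¹)`
  have h4 : dist1 (A * B⁻¹) ≤ ((k + 1 : ℕ) : ℝ) * dist1 (a * a₁⁻¹) := dist1_pow_mul_inv_pow_le a a₁ (k + 1)
  have h5 : 0 ≤ dist1 κ₁ := GaugeGroup.dist1_nonneg _
  have h6 : 2 * dist1 κ₁ * dist1 (A * B⁻¹) ≤ 2 * dist1 κ₁ * (((k + 1 : ℕ) : ℝ) * dist1 (a * a₁⁻¹)) :=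
    mul_le_mul_of_nonneg_left h4 (by positivity)
  linarith

/-! ## §3 The lattice instantiation: the two stage towers at the central face bond `b₀(c)` of a coarse bond `c` -/

section Stage

open Literature.MathematicalPhysics.QuantumLattice (su2Quat)
open T4Continuum BlockAveraging AveragingRT B10Eq47AxialChi
open B10Eq27TorusAxialLog (rel axialT)
open T4CubeChartGnomonic (SU2)
open T4HaarSU2ExpChart (expPoint)
open T4ExpWindowSmallField (logVec expPoint_logVec)
open B12SmallFieldDomain259 (b0 b0_eq_line)
open Summit.QuantumFields.YangMills.Theorems.FluctuationComparisonRegPrIntLS2BetaWhitneyHatLift (lift_line)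
open Summit.QuantumFields.YangMills.Theorems.FluctuationComparisonRegPrIntLS2BetaTreeCombBondStep (stageField_treeComb_eq_lift)
open Summit.QuantumFields.YangMills.Theorems.FluctuationComparisonRegPrIntLS2BetaCentralLineTreeComb
  (blockOf_shiftN_emb_of_le blockOf_shiftN_emb_of_ge rel_emb_shiftN_emb_of_le rel_emb_tgt_shiftN_emb_of_ge)
open Summit.QuantumFields.YangMills.Theorems.FluctuationComparisonRegPrIntLS2BetaSmallBondGaugeToronObstruction (expPoint_smul_pow)

variable {P : Params}

/-- A straight product whose factors all equal `a` is `a^n`. [cite: Balaban1985Averaging, (9) p.19] -/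
theorem rowProd_eq_pow_of_eq {j : ℕ} (W : GaugeField P j G) (x : Site P j) (μ : Fin P.d) (a : G) :
    ∀ n : ℕ, (∀ s, s < n → W ⟨shiftN x μ s, μ⟩ = a) → rowProd W x μ n = a ^ n
  | 0, _ => by rw [rowProd_zero, pow_zero]
  | n + 1, h => by
    rw [rowProd_succ, rowProd_eq_pow_of_eq W x μ a n (fun s hs => h s (Nat.lt_succ_of_lt hs)), h n (Nat.lt_succ_self n), pow_succ]

/-- **THE CENTRAL LINE OFF `b₀(c)` IS TREE-COMB**: for `t < L`, `t ≠ (L−1)∕2`, the bond `⟨emb c₋ + te_μ, μ⟩` stays inside its block under `+e_μ` and has vanishing lower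
relative coordinates (✓p831574's `blockOf_shiftN_emb_of_le ∕ _of_ge`, `rel_emb_…`). [cite: Balaban1987RG1, (0.3) p.252; Balaban1985RegularSpaces, (1.19) p.79] -/
theorem centralLine_treeComb {j : ℕ} (hj : j + 1 ≤ P.m + P.K) (c : PBond P (j + 1)) {t : ℕ} (ht : t < P.L) (hne : t ≠ (P.L - 1) / 2) :
    blockOf ((shiftN (emb c.src) c.dir t).shift c.dir) = blockOf (shiftN (emb c.src) c.dir t) ∧
      ∀ ν, ν < c.dir → rel (emb (blockOf (shiftN (emb c.src) c.dir t))) (shiftN (emb c.src) c.dir t) ν = 0 := by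
  have hL := two_mul_half_add_one P
  rw [← shiftN_succ]
  rcases Nat.lt_or_gt_of_ne hne with hlt | hgt
  · rw [blockOf_shiftN_emb_of_le hj c.src c.dir (t := t + 1) (by omega), blockOf_shiftN_emb_of_le hj c.src c.dir (t := t) hlt.le]
    refine ⟨rfl, fun ν hν => ?_⟩
    rw [rel_emb_shiftN_emb_of_le hj c.src c.dir (t := t) (by omega)]
    simp [Fin.ne_of_lt hν]
  · rw [blockOf_shiftN_emb_of_ge hj c (t := t + 1) (by omega) (by omega), blockOf_shiftN_emb_of_ge hj c (t := t) (by omega) (by omega)]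
    refine ⟨rfl, fun ν hν => ?_⟩
    rw [rel_emb_tgt_shiftN_emb_of_ge hj c (t := t) (by omega) (by omega)]
    simp [Fin.ne_of_lt hν]

/-- ★★ **THE (0.4) IDENTITY AT `c` IN THE FORM `κ·(a^k·u·a^k) = a^{2k+1}` FOR ONE STAGE TOWER.**  With `W := g_j • Ū^jU` the stage field, `X := g_{j+1} • Ū^{j+1}U` the next
one, `V := lift_j X`, `a := expPoint (L⁻¹ • logVec (X c))` (= `V` on the whole central line, ✓`lift_line`), `u := W (b₀ c)`, `κ := corr ℰ W c`: AxStage's (T4) (comb transports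
= lift) and (T5) (`Ū(W) = X`) give `κ·(a^k·u·a^k) = a^{k+(k+1)}` (`k = (L−1)∕2`), the hypothesis `hu` of ✓`dist1_centralDisc_le`.
[cite: Balaban1987RG1, (0.4) p.253; Balaban1985RegularSpaces, (1.19) p.79, (1.29) p.81] -/
theorem avg_identity_central (ℰ : LoopAverage SU2) {j : ℕ} (hj : j + 1 ≤ P.m + P.K)
    (wt : (i : ℕ) → PBond P i → PBond P (i + 1) → ℝ) (lift : (i : ℕ) → GaugeField P (i + 1) SU2 → GaugeField P i SU2)
    (g : (i : ℕ) → Site P i → SU2) (U : GaugeField P 0 SU2)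
    (hwt : ∀ b e, wt j b e = if e.dir = b.dir ∧ (b.src b.dir - emb e.src b.dir).val < P.L then
      ∏ ν ∈ Finset.univ.erase b.dir, max 0 (1 - ((rel (emb e.src) b.src ν).natAbs : ℝ) / P.L) else 0)
    (hlift : ∀ (X : GaugeField P (j + 1) SU2) (b : PBond P j), lift j X b = expPoint (∑ e, wt j b e • ((P.L : ℝ)⁻¹ • logVec (su2Quat (X e)))))
    (hT4 : ∀ x, axialT (GaugeField.gaugeAct (g j) (Averaging.iter (fun i => blockAvg (P := P) (j := i) ℰ) j U)) (emb (blockOf x)) x =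
      axialT (lift j (GaugeField.gaugeAct (g (j + 1)) (Averaging.iter (fun i => blockAvg (P := P) (j := i) ℰ) (j + 1) U))) (emb (blockOf x)) x)
    (hT5 : (blockAvg (P := P) (j := j) ℰ).avg (GaugeField.gaugeAct (g j) (Averaging.iter (fun i => blockAvg (P := P) (j := i) ℰ) j U)) =
      GaugeField.gaugeAct (g (j + 1)) (Averaging.iter (fun i => blockAvg (P := P) (j := i) ℰ) (j + 1) U))
    (c : PBond P (j + 1)) :
    corr ℰ (GaugeField.gaugeAct (g j) (Averaging.iter (fun i => blockAvg (P := P) (j := i) ℰ) j U)) c *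
        (expPoint ((P.L : ℝ)⁻¹ • logVec (su2Quat (GaugeField.gaugeAct (g (j + 1)) (Averaging.iter (fun i => blockAvg (P := P) (j := i) ℰ) (j + 1) U) c))) ^ ((P.L - 1) / 2) *
          GaugeField.gaugeAct (g j) (Averaging.iter (fun i => blockAvg (P := P) (j := i) ℰ) j U) (b0 c) *
          expPoint ((P.L : ℝ)⁻¹ • logVec (su2Quat (GaugeField.gaugeAct (g (j + 1)) (Averaging.iter (fun i => blockAvg (P := P) (j := i) ℰ) (j + 1) U) c))) ^ ((P.L - 1) / 2)) =
      expPoint ((P.L : ℝ)⁻¹ • logVec (su2Quat (GaugeField.gaugeAct (g (j + 1)) (Averaging.iter (fun i => blockAvg (P := P) (j := i) ℰ) (j + 1) U) c))) ^ ((P.L - 1) / 2 + ((P.L - 1) / 2 + 1)) := by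
  have hL := two_mul_half_add_one P
  have hLpos : (0 : ℝ) < P.L := by exact_mod_cast P.L_pos
  -- names
  set W : GaugeField P j SU2 := GaugeField.gaugeAct (g j) (Averaging.iter (fun i => blockAvg (P := P) (j := i) ℰ) j U) with hW
  set X : GaugeField P (j + 1) SU2 := GaugeField.gaugeAct (g (j + 1)) (Averaging.iter (fun i => blockAvg (P := P) (j := i) ℰ) (j + 1) U) with hX
  set a : SU2 := expPoint ((P.L : ℝ)⁻¹ • logVec (su2Quat (X c))) with ha
  set k : ℕ := (P.L - 1) / 2 with hk
  -- the right-hand side is `X c`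
  have haL : a ^ (k + (k + 1)) = X c := by
    rw [ha, expPoint_smul_pow, show (((k + (k + 1) : ℕ) : ℝ)) * (P.L : ℝ)⁻¹ = 1 by
      rw [show k + (k + 1) = P.L by omega]; field_simp, one_smul, expPoint_logVec]
  -- the comb bonds of the central line carry `a`
  have hWa : ∀ t, t < P.L → t ≠ k → W ⟨shiftN (emb c.src) c.dir t, c.dir⟩ = a := by
    intro t ht hne
    obtain ⟨hblk, hlo⟩ := centralLine_treeComb hj c ht hne
    have h1 := stageField_treeComb_eq_lift (fun i => blockAvg (P := P) (j := i) ℰ) hj lift g U hT4 _ c.dir hblk hlo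
    rw [hW, h1, ← lineSite_eq_shiftN, show (⟨lineSite c t, c.dir⟩ : PBond P j) = line c t from rfl,
      lift_line hj (wt j) hwt X (lift j X) (fun b => hlift X b) c ht]
  -- the central bond is `b₀(c)`
  have hb0 : (⟨shiftN (emb c.src) c.dir k, c.dir⟩ : PBond P j) = b0 c := by
    rw [B12B0LoopGeometry267.b0_eq_shiftN_emb]
  -- the central-line product is `a^k·u·a^k`
  have hrow : rowProd W (emb c.src) c.dir P.L = a ^ k * W (b0 c) * a ^ k := by
    rw [B12B0LoopGeometry267.rowProd_eq_split W (emb c.src) c.dir (t := k) (m := P.L) (by omega),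
      rowProd_eq_pow_of_eq W (emb c.src) c.dir a k (fun s hs => hWa s (by omega) (by omega)), hb0,
      rowProd_eq_pow_of_eq W (shiftN (emb c.src) c.dir (k + 1)) c.dir a (P.L - k - 1) (fun s hs => by
        -- `x + (a+b)e_μ = (x + a e_μ) + b e_μ` (proof-local, as in ✓p831296; the tree has it under `ApproxLift.shiftN_add`)
        have hsh : ∀ (a b : ℕ), shiftN (emb c.src) c.dir (a + b) = shiftN (shiftN (emb c.src) c.dir a) c.dir b := by
          intro a b
          induction b with
          | zero => rfl
          | succ b ih => rw [← Nat.add_assoc, shiftN_succ, ih, shiftN_succ]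
        rw [← hsh]; exact hWa (k + 1 + s) (by omega) (by omega)),
      show P.L - k - 1 = k by omega]
  -- (0.4): `X c = corr·rowProd`
  have h04 : X c = corr ℰ W c * rowProd W (emb c.src) c.dir P.L := by
    have h1 : avgFun ℰ W = X := by rw [← blockAvg_avg]; exact hT5
    rw [← h1]
    show corr ℰ W c * axialAvg W c = corr ℰ W c * rowProd W (emb c.src) c.dir P.L
    rw [B12B0LoopStructure267.axialAvg_eq_rowProd]
  rw [haL, h04, hrow]

/-- ★★★ **THE CENTRAL FACE BOND's DISCREPANCY, AT THE LATTICE**: for the two `AxStage` stage towers (hat weights, hat lift, (T4)×2, (T5)×2 at level `j`) and the `SU(2)`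
commutator letter, at the central face bond `b₀(c)` of every coarse bond `c` the discrepancy `ε := R⁻¹·η` (`R = lift_j X (b₀ c)·(lift_j X₁ (b₀ c))⁻¹`,
`η = W (b₀ c)·(W₁ (b₀ c))⁻¹`) obeys `dist1 ε ≤ dist1 (corr ℰ W c·(corr ℰ W₁ c)⁻¹) + 2·dist1 (corr ℰ W₁ c)·(((L−1)∕2 + 1)·dist1 R)` — the RELATIVE (0.4) CORRECTION FACTOR
(✓p831296 §3 linearises it into an `Idx`-mean of covariant CLOSED-loop sums: c₁'s curl currency) plus an (absolute correction × relative lift) commutator price (feedback). This is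
the central-bond discharge of ⧗Q11g's `hface`; off-centre face bonds add px5's transverse ladders. [cite: Balaban1987RG1, (0.4) p.253; Balaban1985Averaging, (19)-(20) p.21; Balaban1985RegularSpaces, (1.19) p.79, (1.29) p.81] -/
theorem dist1_centralDisc_le_stage (ℰ : LoopAverage SU2) {j : ℕ} (hj : j + 1 ≤ P.m + P.K)
    (wt : (i : ℕ) → PBond P i → PBond P (i + 1) → ℝ) (lift : (i : ℕ) → GaugeField P (i + 1) SU2 → GaugeField P i SU2)
    (g g₀ : (i : ℕ) → Site P i → SU2) (U U₁ : GaugeField P 0 SU2)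
    (hwt : ∀ b e, wt j b e = if e.dir = b.dir ∧ (b.src b.dir - emb e.src b.dir).val < P.L then
      ∏ ν ∈ Finset.univ.erase b.dir, max 0 (1 - ((rel (emb e.src) b.src ν).natAbs : ℝ) / P.L) else 0)
    (hlift : ∀ (X : GaugeField P (j + 1) SU2) (b : PBond P j), lift j X b = expPoint (∑ e, wt j b e • ((P.L : ℝ)⁻¹ • logVec (su2Quat (X e)))))
    (hT4 : ∀ x, axialT (GaugeField.gaugeAct (g j) (Averaging.iter (fun i => blockAvg (P := P) (j := i) ℰ) j U)) (emb (blockOf x)) x =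
      axialT (lift j (GaugeField.gaugeAct (g (j + 1)) (Averaging.iter (fun i => blockAvg (P := P) (j := i) ℰ) (j + 1) U))) (emb (blockOf x)) x)
    (hT4' : ∀ x, axialT (GaugeField.gaugeAct (g₀ j) (Averaging.iter (fun i => blockAvg (P := P) (j := i) ℰ) j U₁)) (emb (blockOf x)) x =
      axialT (lift j (GaugeField.gaugeAct (g₀ (j + 1)) (Averaging.iter (fun i => blockAvg (P := P) (j := i) ℰ) (j + 1) U₁))) (emb (blockOf x)) x)
    (hT5 : (blockAvg (P := P) (j := j) ℰ).avg (GaugeField.gaugeAct (g j) (Averaging.iter (fun i => blockAvg (P := P) (j := i) ℰ) j U)) =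
      GaugeField.gaugeAct (g (j + 1)) (Averaging.iter (fun i => blockAvg (P := P) (j := i) ℰ) (j + 1) U))
    (hT5' : (blockAvg (P := P) (j := j) ℰ).avg (GaugeField.gaugeAct (g₀ j) (Averaging.iter (fun i => blockAvg (P := P) (j := i) ℰ) j U₁)) =
      GaugeField.gaugeAct (g₀ (j + 1)) (Averaging.iter (fun i => blockAvg (P := P) (j := i) ℰ) (j + 1) U₁))
    (hcomm : ∀ x y : SU2, dist1 (x * y * x⁻¹ * y⁻¹) ≤ 2 * dist1 x * dist1 y)
    (c : PBond P (j + 1)) :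
    dist1 ((lift j (GaugeField.gaugeAct (g (j + 1)) (Averaging.iter (fun i => blockAvg (P := P) (j := i) ℰ) (j + 1) U)) (b0 c) *
          (lift j (GaugeField.gaugeAct (g₀ (j + 1)) (Averaging.iter (fun i => blockAvg (P := P) (j := i) ℰ) (j + 1) U₁)) (b0 c))⁻¹)⁻¹ *
        (GaugeField.gaugeAct (g j) (Averaging.iter (fun i => blockAvg (P := P) (j := i) ℰ) j U) (b0 c) *
          (GaugeField.gaugeAct (g₀ j) (Averaging.iter (fun i => blockAvg (P := P) (j := i) ℰ) j U₁) (b0 c))⁻¹)) ≤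
      dist1 (corr ℰ (GaugeField.gaugeAct (g j) (Averaging.iter (fun i => blockAvg (P := P) (j := i) ℰ) j U)) c *
          (corr ℰ (GaugeField.gaugeAct (g₀ j) (Averaging.iter (fun i => blockAvg (P := P) (j := i) ℰ) j U₁)) c)⁻¹) +
        2 * dist1 (corr ℰ (GaugeField.gaugeAct (g₀ j) (Averaging.iter (fun i => blockAvg (P := P) (j := i) ℰ) j U₁)) c) *
          ((((P.L - 1) / 2 + 1 : ℕ) : ℝ) *
            dist1 (lift j (GaugeField.gaugeAct (g (j + 1)) (Averaging.iter (fun i => blockAvg (P := P) (j := i) ℰ) (j + 1) U)) (b0 c) *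
              (lift j (GaugeField.gaugeAct (g₀ (j + 1)) (Averaging.iter (fun i => blockAvg (P := P) (j := i) ℰ) (j + 1) U₁)) (b0 c))⁻¹)) := by
  have hL := two_mul_half_add_one P
  have hu := avg_identity_central ℰ hj wt lift g U hwt hlift hT4 hT5 c
  have hu₁ := avg_identity_central ℰ hj wt lift g₀ U₁ hwt hlift hT4' hT5' c
  -- the lifts at `b₀(c) = line c k` are the `L`-th roots
  have hb : ∀ (Y : GaugeField P (j + 1) SU2), lift j Y (b0 c) = expPoint ((P.L : ℝ)⁻¹ • logVec (su2Quat (Y c))) := fun Y => by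
    rw [b0_eq_line]
    exact lift_line hj (wt j) hwt Y (lift j Y) (fun b => hlift Y b) c (k := (P.L - 1) / 2) (by omega)
  rw [hb, hb]
  exact dist1_centralDisc_le hcomm _ _ _ _ _ _ ((P.L - 1) / 2) hu hu₁

end Stage

end Summit.QuantumFields.YangMills.Theorems.FluctuationComparisonRegPrIntLS2BetaCentralFaceDiscrepancy
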